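import Literature.MathematicalPhysics.QuantumLattice.DWaveSourceNNNHoppingEnergyDensityExists
import Literature.MathematicalPhysics.QuantumLattice.HubbardTTPrimeWindowCertificateConvexComb
import HarnessLib

/-!
# Joint concavity of the sourced energy density `e_src(t', U, μ, h)` in ALL couplings and the
# barycentric / `μ`-direction transport rules (the fast layer's box rules verbatim for the sourced model)

Topic `Literature/MathematicalPhysics/QuantumLattice` (family `hubbard`); sequel of
`DWaveSourceNNNHoppingEnergyDensityExists.lean` (`e_src(t',U,μ,h) = dWaveSourceEnergyDensityTT' t' U μ h`
EXISTS and is the MINIMUM of `Re ω(E^src(t',U,μ,h))` over translation-invariant infinite-volume states).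
Since the local objective `E^src = dWaveSourceEnergyObsTT' t' U μ h` is AFFINE in the coupling vector
`(t', U, μ, h)` (`dWaveSourceEnergyObsTT'_convexComb`; the `t–t'` part by the tree's
`hubbardTTPrimeFermionInteraction_convexComb` / `FermionInteraction.meanEnergyObs_of_sum`), the minimum of
affine functions `e_src` is JOINTLY CONCAVE in `(t', U, μ, h)` — with NO sign restriction on `U` (the
grand-canonical problem is minimised over the whole Fock space). Written for the cuprate cell
(`hubbard-cq`; pilots certify the sourced torus at several `(μ, h)` around the CQ anchors
`(U,t') = (8, 0), (8, −1/4)`): certified LOWER bounds at finitely many coupling anchors certify every point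
of their convex hull from below, exactly as the fast layer's `energyDensityTT'_ge_sum_lowerBounds`
(`HubbardNNNHoppingEnergyDensityRegionBounds` §2) does for the canonical `t–t'` density.

* `dWaveSourceEnergyDensityTT'_zero_tp` — at `t' = 0` the `t–t'` object IS `dWaveSourceEnergyDensity`.
* `dWaveSourceEnergyObsTT'_convexComb` — affinity of `E^src` in `(t', U, μ, h)`.
* `sum_mul_dWaveSourceEnergyDensityTT'_le` — JENSEN: `Σ wᵢ e_src(cᵢ) ≤ e_src(Σ wᵢ cᵢ)` for convex weights;
  `concaveOn_dWaveSourceEnergyDensityTT'_couplings` — `ConcaveOn ℝ univ` on `ℝ × ℝ × ℝ × ℝ`.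
* TRANSPORT: `dWaveSourceEnergyDensityTT'_ge_sum_lowerBounds` (barycentric lower bound from certified
  anchor lower bounds), and the `μ`-direction rules at fixed `(t', U, h)`: chord lower bound
  `dWaveSourceEnergyDensityTT'_ge_mu_chord`, outward upper bound `dWaveSourceEnergyDensityTT'_le_mu_extrapolate`.

Everything is PROVED; no definition, no named fact. HONEST SCOPE: bookkeeping inequalities for certified
windows on `e_src`; nothing here bears on `d`-wave order.

## References
* R. B. Israel, *Convexity in the Theory of Lattice Gases* (1979), Thm. I.3.4 (the pressure / ground-state
  energy density is concave on the space of interactions). [cite: Israel1979, Thm. I.3.4]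
* T. Koma, H. Tasaki, J. Stat. Phys. 76 (1994) 745, §1. [cite: KomaTasaki1994, §1]
* R. B. Griffiths, J. Math. Phys. 5 (1964) 1215, §II (secant bounds). [cite: Griffiths1964, §II]
-/

noncomputable section

namespace Literature.MathematicalPhysics.QuantumLattice

open _root_.Matrix Finset HubbardWave0 Literature.Probability.LatticeModels _root_.Filter
open scoped _root_.Topology ComplexOrder BigOperators

/-! ### `t' = 0` -/

/-- At `t' = 0` the `t–t'` sourced energy density is `dWaveSourceEnergyDensity` (the defining sequences
coincide term by term, `dWaveSourceTorusTT'_zero_tp`). [cite: KomaTasaki1994, §1] -/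
theorem dWaveSourceEnergyDensityTT'_zero_tp (U μ h : ℝ) :
    dWaveSourceEnergyDensityTT' 0 U μ h = dWaveSourceEnergyDensity U μ h := by
  unfold dWaveSourceEnergyDensityTT' dWaveSourceEnergyDensity
  simp_rw [dWaveSourceTorusTT'_zero_tp]

/-! ### Affinity of the local objective in the couplings -/

/-- The three pieces of `E^src_{t'}` (definitional): the `t–t'` mean-energy observable, the density at the
origin and the `d`-wave pair word of the origin. [cite: KomaTasaki1994, §1] -/
theorem dWaveSourceEnergyObsTT'_eq (tp U μ h : ℝ) :
    dWaveSourceEnergyObsTT' tp U μ h =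
      fermionEmbed (PolySite.incl thicken_subset_dWaveSourceWindow)
          ((hubbardTTPrimeFermionInteraction 1 tp U).meanEnergyObs 1) -
        (μ : ℂ) • ∑ σ : Fin 2, nAt 0 zero_mem_dWaveSourceWindow σ -
        (h : ℂ) • (fermionEmbed (PolySite.incl pairRegion_subset_dWaveSourceWindow)
            (localPairAt (insert (0 : Site 2) unitSteps) dWaveFormFactor 0) +
          (fermionEmbed (PolySite.incl pairRegion_subset_dWaveSourceWindow)
            (localPairAt (insert (0 : Site 2) unitSteps) dWaveFormFactor 0))ᴴ) :=
  rfl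

/-- **`E^src` is affine in the coupling vector `(t', U, μ, h)`**: for weights with `Σ wᵢ = 1`,
`E^src(Σ wᵢ t'ᵢ, Σ wᵢ Uᵢ, Σ wᵢ μᵢ, Σ wᵢ hᵢ) = Σ wᵢ • E^src(t'ᵢ, Uᵢ, μᵢ, hᵢ)`. [cite: Israel1979, Thm. I.3.4] -/
theorem dWaveSourceEnergyObsTT'_convexComb {ι : Type*} (S : Finset ι) (w : ι → ℝ)
    (hw1 : ∑ i ∈ S, w i = 1) (tp U μ h : ι → ℝ) :
    dWaveSourceEnergyObsTT' (∑ i ∈ S, w i * tp i) (∑ i ∈ S, w i * U i) (∑ i ∈ S, w i * μ i)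
        (∑ i ∈ S, w i * h i) =
      ∑ i ∈ S, ((w i : ℝ) : ℂ) • dWaveSourceEnergyObsTT' (tp i) (U i) (μ i) (h i) := by
  -- the `t–t'` mean-energy observable is affine
  have hA : (hubbardTTPrimeFermionInteraction 1 (∑ i ∈ S, w i * tp i) (∑ i ∈ S, w i * U i)).meanEnergyObs 1 =
      ∑ i ∈ S, ((w i : ℝ) : ℂ) • (hubbardTTPrimeFermionInteraction 1 (tp i) (U i)).meanEnergyObs 1 :=
    FermionInteraction.meanEnergyObs_of_sum (hubbardTTPrimeFermionInteraction_convexComb S w hw1 1 tp U) 1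
  simp_rw [dWaveSourceEnergyObsTT'_eq]
  generalize (∑ σ : Fin 2, nAt 0 zero_mem_dWaveSourceWindow σ : FermionOp dWaveSourceWindow) = N
  generalize (fermionEmbed (PolySite.incl pairRegion_subset_dWaveSourceWindow)
        (localPairAt (insert (0 : Site 2) unitSteps) dWaveFormFactor 0) +
      (fermionEmbed (PolySite.incl pairRegion_subset_dWaveSourceWindow)
        (localPairAt (insert (0 : Site 2) unitSteps) dWaveFormFactor 0))ᴴ : FermionOp dWaveSourceWindow) = P
  rw [hA, fermionEmbed_sum]
  simp_rw [fermionEmbed_smul, smul_sub, Finset.sum_sub_distrib, Complex.ofReal_sum, Finset.sum_smul,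
    Complex.ofReal_mul, mul_smul]

/-! ### Joint concavity (Jensen) -/

/-- **JENSEN / joint concavity in all couplings**: for convex weights `wᵢ ≥ 0`, `Σ wᵢ = 1`,
`Σ wᵢ e_src(t'ᵢ,Uᵢ,μᵢ,hᵢ) ≤ e_src(Σ wᵢ t'ᵢ, Σ wᵢ Uᵢ, Σ wᵢ μᵢ, Σ wᵢ hᵢ)` — the minimum over translation-invariant
states of the affine `Re ω(E^src)` is concave. [cite: Israel1979, Thm. I.3.4] -/
theorem sum_mul_dWaveSourceEnergyDensityTT'_le {ι : Type*} (S : Finset ι) (w : ι → ℝ)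
    (hw0 : ∀ i ∈ S, 0 ≤ w i) (hw1 : ∑ i ∈ S, w i = 1) (tp U μ h : ι → ℝ) :
    ∑ i ∈ S, w i * dWaveSourceEnergyDensityTT' (tp i) (U i) (μ i) (h i) ≤
      dWaveSourceEnergyDensityTT' (∑ i ∈ S, w i * tp i) (∑ i ∈ S, w i * U i) (∑ i ∈ S, w i * μ i)
        (∑ i ∈ S, w i * h i) := by
  obtain ⟨ω, hω, hωe⟩ := exists_re_expect_eq_dWaveSourceEnergyDensityTT' (∑ i ∈ S, w i * tp i)
    (∑ i ∈ S, w i * U i) (∑ i ∈ S, w i * μ i) (∑ i ∈ S, w i * h i)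
  rw [← hωe, dWaveSourceEnergyObsTT'_convexComb S w hw1 tp U μ h, map_sum, Complex.re_sum]
  refine Finset.sum_le_sum fun i hi => ?_
  rw [LinearMap.map_smul, smul_eq_mul, Complex.re_ofReal_mul]
  exact mul_le_mul_of_nonneg_left
    (dWaveSourceEnergyDensityTT'_le_re_expect (tp i) (U i) (μ i) (h i) ω hω) (hw0 i hi)

/-- **Two-point form**: `p e_src(c₁) + q e_src(c₂) ≤ e_src(p c₁ + q c₂)` componentwise in `(t', U, μ, h)`,
`p, q ≥ 0`, `p + q = 1`. [cite: Israel1979, Thm. I.3.4] -/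
theorem dWaveSourceEnergyDensityTT'_convexComb_couplings_ge {tp₁ U₁ μ₁ h₁ tp₂ U₂ μ₂ h₂ p q : ℝ}
    (hp : 0 ≤ p) (hq : 0 ≤ q) (hpq : p + q = 1) :
    p * dWaveSourceEnergyDensityTT' tp₁ U₁ μ₁ h₁ + q * dWaveSourceEnergyDensityTT' tp₂ U₂ μ₂ h₂ ≤
      dWaveSourceEnergyDensityTT' (p * tp₁ + q * tp₂) (p * U₁ + q * U₂) (p * μ₁ + q * μ₂)
        (p * h₁ + q * h₂) := by
  have key := sum_mul_dWaveSourceEnergyDensityTT'_le (Finset.univ : Finset Bool)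
    (fun b => if b then p else q) (fun b _ => by cases b <;> simp [hp, hq])
    (by simp [hpq])
    (fun b => if b then tp₁ else tp₂) (fun b => if b then U₁ else U₂) (fun b => if b then μ₁ else μ₂)
    (fun b => if b then h₁ else h₂)
  simpa [Fintype.sum_bool] using key

/-- **`ConcaveOn` form on the coupling space `ℝ × ℝ × ℝ × ℝ = {(t', U, μ, h)}`.** [cite: Israel1979, Thm. I.3.4] -/
theorem concaveOn_dWaveSourceEnergyDensityTT'_couplings :
    ConcaveOn ℝ Set.univ fun c : ℝ × ℝ × ℝ × ℝ => dWaveSourceEnergyDensityTT' c.1 c.2.1 c.2.2.1 c.2.2.2 := by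
  refine ⟨convex_univ, fun x _ y _ p q hp hq hpq => ?_⟩
  simp only [smul_eq_mul, Prod.smul_fst, Prod.smul_snd, Prod.fst_add, Prod.snd_add]
  exact dWaveSourceEnergyDensityTT'_convexComb_couplings_ge hp hq hpq

/-! ### Transport of certified windows across couplings -/

/-- **Barycentric LOWER bound from certified anchors**: lower bounds `loᵢ ≤ e_src(t'ᵢ,Uᵢ,μᵢ,hᵢ)` at
finitely many coupling anchors and convex weights give `Σ wᵢ loᵢ ≤ e_src(Σ wᵢ cᵢ)` — every point of the
convex hull of certified anchors is certified from below. [cite: Israel1979, Thm. I.3.4] -/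
theorem dWaveSourceEnergyDensityTT'_ge_sum_lowerBounds {ι : Type*} (S : Finset ι) (w : ι → ℝ)
    (hw0 : ∀ i ∈ S, 0 ≤ w i) (hw1 : ∑ i ∈ S, w i = 1) (tp U μ h lo : ι → ℝ)
    (hlo : ∀ i ∈ S, lo i ≤ dWaveSourceEnergyDensityTT' (tp i) (U i) (μ i) (h i)) :
    ∑ i ∈ S, w i * lo i ≤
      dWaveSourceEnergyDensityTT' (∑ i ∈ S, w i * tp i) (∑ i ∈ S, w i * U i) (∑ i ∈ S, w i * μ i)
        (∑ i ∈ S, w i * h i) := by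
  refine le_trans ?_ (sum_mul_dWaveSourceEnergyDensityTT'_le S w hw0 hw1 tp U μ h)
  exact Finset.sum_le_sum fun i hi => mul_le_mul_of_nonneg_left (hlo i hi) (hw0 i hi)

/-- **Chord LOWER bound in the chemical potential** (fixed `t', U, h`): for `μ₁ < μ₂`, `μ ∈ [μ₁, μ₂]`,
certified `lo₁ ≤ e_src(μ₁)`, `lo₂ ≤ e_src(μ₂)`:
`lo₁ + (lo₂ − lo₁)(μ − μ₁)/(μ₂ − μ₁) ≤ e_src(μ)`. [cite: Griffiths1964, §II] -/
theorem dWaveSourceEnergyDensityTT'_ge_mu_chord (tp U h : ℝ) {μ₁ μ₂ μ lo₁ lo₂ : ℝ} (hlt : μ₁ < μ₂)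
    (ha : μ₁ ≤ μ) (hb : μ ≤ μ₂) (h1 : lo₁ ≤ dWaveSourceEnergyDensityTT' tp U μ₁ h)
    (h2 : lo₂ ≤ dWaveSourceEnergyDensityTT' tp U μ₂ h) :
    lo₁ + (lo₂ - lo₁) * (μ - μ₁) / (μ₂ - μ₁) ≤ dWaveSourceEnergyDensityTT' tp U μ h := by
  have hd : 0 < μ₂ - μ₁ := sub_pos.2 hlt
  set q : ℝ := (μ - μ₁) / (μ₂ - μ₁) with hqdef
  set p : ℝ := 1 - q with hpdef
  have hq0 : 0 ≤ q := div_nonneg (sub_nonneg.2 ha) hd.le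
  have hq1 : q ≤ 1 := by rw [hqdef, div_le_one hd]; linarith
  have hp0 : 0 ≤ p := by rw [hpdef]; linarith
  have hpq : p + q = 1 := by rw [hpdef]; ring
  have key := dWaveSourceEnergyDensityTT'_convexComb_couplings_ge (tp₁ := tp) (U₁ := U) (μ₁ := μ₁)
    (h₁ := h) (tp₂ := tp) (U₂ := U) (μ₂ := μ₂) (h₂ := h) hp0 hq0 hpq
  have e1 : p * tp + q * tp = tp := by rw [← add_mul, hpq, one_mul]
  have e2 : p * U + q * U = U := by rw [← add_mul, hpq, one_mul]
  have e3 : p * h + q * h = h := by rw [← add_mul, hpq, one_mul]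
  have e4 : p * μ₁ + q * μ₂ = μ := by rw [hpdef, hqdef]; field_simp; ring
  rw [e1, e2, e3, e4] at key
  have hval : p * lo₁ + q * lo₂ = lo₁ + (lo₂ - lo₁) * (μ - μ₁) / (μ₂ - μ₁) := by
    rw [hpdef, hqdef]; field_simp; ring
  nlinarith [key, hval, mul_le_mul_of_nonneg_left h1 hp0, mul_le_mul_of_nonneg_left h2 hq0]

/-- **Outward UPPER bound in the chemical potential** (fixed `t', U, h`): a certified `lo₁ ≤ e_src(μ₁)` and
`e_src(μ₂) ≤ hi₂` give at `μ₃ = μ₂ + θ(μ₂ − μ₁)` (`θ ≥ 0`) `e_src(μ₃) ≤ hi₂ + θ(hi₂ − lo₁)`.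
[cite: Griffiths1964, §II] -/
theorem dWaveSourceEnergyDensityTT'_le_mu_extrapolate (tp U h : ℝ) {μ₁ μ₂ θ lo₁ hi₂ : ℝ} (hθ : 0 ≤ θ)
    (h1 : lo₁ ≤ dWaveSourceEnergyDensityTT' tp U μ₁ h) (h2 : dWaveSourceEnergyDensityTT' tp U μ₂ h ≤ hi₂) :
    dWaveSourceEnergyDensityTT' tp U (μ₂ + θ * (μ₂ - μ₁)) h ≤ hi₂ + θ * (hi₂ - lo₁) := by
  have h1θ : 0 < 1 + θ := by linarith
  set p : ℝ := θ / (1 + θ) with hpdef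
  set q : ℝ := 1 / (1 + θ) with hqdef
  have hp0 : 0 ≤ p := div_nonneg hθ h1θ.le
  have hq0 : 0 ≤ q := div_nonneg zero_le_one h1θ.le
  have hpq : p + q = 1 := by rw [hpdef, hqdef, ← add_div, add_comm, div_self h1θ.ne']
  have key := dWaveSourceEnergyDensityTT'_convexComb_couplings_ge (tp₁ := tp) (U₁ := U) (μ₁ := μ₁)
    (h₁ := h) (tp₂ := tp) (U₂ := U) (μ₂ := μ₂ + θ * (μ₂ - μ₁)) (h₂ := h) hp0 hq0 hpq
  have e1 : p * tp + q * tp = tp := by rw [← add_mul, hpq, one_mul]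
  have e2 : p * U + q * U = U := by rw [← add_mul, hpq, one_mul]
  have e3 : p * h + q * h = h := by rw [← add_mul, hpq, one_mul]
  have e4 : p * μ₁ + q * (μ₂ + θ * (μ₂ - μ₁)) = μ₂ := by rw [hpdef, hqdef]; field_simp; ring
  rw [e1, e2, e3, e4] at key
  have hc' : θ * dWaveSourceEnergyDensityTT' tp U μ₁ h + dWaveSourceEnergyDensityTT' tp U (μ₂ + θ * (μ₂ - μ₁)) h ≤
      (1 + θ) * dWaveSourceEnergyDensityTT' tp U μ₂ h := by
    have := mul_le_mul_of_nonneg_left key h1θ.le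
    have e5 : (1 + θ) * (p * dWaveSourceEnergyDensityTT' tp U μ₁ h +
        q * dWaveSourceEnergyDensityTT' tp U (μ₂ + θ * (μ₂ - μ₁)) h) =
        θ * dWaveSourceEnergyDensityTT' tp U μ₁ h + dWaveSourceEnergyDensityTT' tp U (μ₂ + θ * (μ₂ - μ₁)) h := by
      rw [hpdef, hqdef]; field_simp
    linarith [this, e5]
  nlinarith [hc', mul_le_mul_of_nonneg_left h1 hθ, mul_le_mul_of_nonneg_left h2 h1θ.le]

end Literature.MathematicalPhysics.QuantumLattice

end
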